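/-
Copyright (c) 2026 the pub-hodgecm-mathlib formalisation cell (harness21).  Dealer ∕ tier-0 assembler seat hodgecm-mathlib-LH4-plan (g10) (heir LEAD F0P3a-plan T17-36
«dealer starts the tier-1 modules»; F0P3a-p01 (g30) 20:35:46Z hand-back of U4_Rows; desk INVENTORY-TIER1 v1.1 §U4 `unipotentClasses_wild ∕ table_entries ∕ rankTable_det`).
2026-09-03.  OFFERED FOR FILING BY A PROVER SEAT (the dealer files nothing): target `Theorems/F0P3cDyRamFourFrameUnipotentLabelDefs.lean`, def lane
`--supports stmt-HodgeConjecture-24833 --as helper`.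
-/
import Summits.HodgeConjecture.HodgeConjecture.Theorems.F0P3cDyRamFourFramePieces   -- ★ DEFS №3 (p854653): `wMatrix`, `xPlus`, `dOfPlace`, `gselStar`, `RankTableWild`
import HarnessLib

/-!
# F0 · P3c · line «(D-RAM) FOUR-FRAME» — DEFS LEAF №6 «UNIPOTENT LABEL»: the explicit labelling `unipotentLabel : ConjClasses G_v → Fin 4` of unit (iv-a)

Cell `pub/hodgecm-mathlib`, crux H413 = `stmt-HodgeConjecture-24833` (helper lane), route HCCMUnconditional; tier-1 unit `U4_Rows` §2 «RANK′-WILD TABLE»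
(assembler: dealer LH4-plan (g10) after F0P3a-p01 (g30)'s hand-back 20:35:46Z).  DEF LANE: `def`s ONLY (no theorem, no instance, no notation, no `sorry`, no named
fact, no `set_option`).

WHY A TREE MODULE (T11-93 ∕ LEAD (R-10)(c) «no shared ∃-witness across stubs»).  ★ `RankTableWild gsel` (DEFS №3 §4 U4-b) asks, for every admissible unipotent
datum `(S, mU)`, for an INJECTIVE labelling `e : ↥S → Fin 4` whose orbital-integral table `(O_u(gsel (e u')))_{u,u' ∈ S}` is invertible.  The U4 module cuts this into
THREE independently provable stubs — (T1) the labelling is injective on unipotent classes (CLASSIFICATION: `{1, T₊, T₋, reg}`), (T2) the table vanishes strictly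
above the diagonal (SUPPORT), (T3) the diagonal entries are non-zero (POSITIVITY) — and a sorry-free assembly (lower-triangular ⇒ `det = ∏ diagonal ≠ 0`).  For the
three stubs to talk about THE SAME labelling without sharing an `∃`-witness, the labelling must be an explicit TREE NAME: this leaf gives it one, in ★ №3's
vocabulary only.

THE OBJECTS (`K = L_w`, `σ = σ_w`, `Φ₃` antidiagonal, `X := wMatrix u − 1` the nilpotent part of a unipotent `u`, read at `w` through ★ `localNonsplitEquiv`):
* `NormClassPlus σ ϖ d X` — «the non-zero values `⟨y, X·y⟩_{Φ₃}` of `X` lie in the norm class of the reference class-`+` nilpotent `xPlus σ ϖ d`»: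
  `∃ y y' z, ⟨y, Xy⟩ ≠ 0 ∧ ⟨y, Xy⟩ = ⟨y', X₊y'⟩ · (z·σz)`.  For a unitary transvection `X = a·w·w^*Φ₃` (`w` isotropic, `a` skew) the non-zero values are exactly
  `a·N(E^×)` and those of `X₊ = c·E₁₃` are `c·N(E^×)`, so the predicate reads `a∕c ∈ N(E^×)` — a `U(Φ₃)(K)`-CONJUGATION INVARIANT of `X` (a unitary `g` only
  re-parametrises `y ↦ g⁻¹y`), hence a class function, representative-free; on ★ №3's shell `NearTransvShell ϖ ℓ₀ m*` it agrees with the level-`m*` label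
  `LabelPlus σ ϖ d m*` (REF1 (g19) m25 (i): at precision `m* − ℓ₀ = 2d − 1` = conductor `d` the value set mod `ϖ^{m*}` IS the norm class).  Relative to the SAME
  uniformiser binder `ϖ` as the pieces (the `±` naming is `ϖ`-relative on both sides, consistently).
* `unipotentLabel L w hw ϖ c : Fin 4` — `0` if `X = 0` (the identity class), `1` if `X ≠ 0`, `X² = 0`, `NormClassPlus` (transvection of class `+`), `2` if `X ≠ 0`,
  `X² = 0`, `¬NormClassPlus` (class `−`), `3` otherwise (`X² ≠ 0`: on unipotent classes, the REGULAR ones).  Column order = ★ `gselStar = (1_K, f_{T+}, f_{T−}, f_reg)`.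
Nothing is asserted.  That `unipotentLabel` is INJECTIVE on unipotent classes (two transvection classes `↔ F^×∕N(E^×)`, ONE regular unipotent class — `H¹(F, Z) →
H¹(F, U₃)` injective in odd rank; F0P3a-p01 census memo v1.2 §4, desk INVENTORY v1.1 §U4 `unipotentClasses_wild`) is the U4 stub `stub_U4_label_injOn`, a PROVER
TARGET; if a wild place carried a second regular class the stub would die and the selector would need a fifth piece (kill-switch recorded on the U4 card).
HONEST LABEL: HC_CM is proved only modulo the 7 printed citations (2 remaining: hLiu418 = stmt-HodgeConjecture-24832, h413 = stmt-HodgeConjecture-24833) until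
rung 0 closes; count-neutral vehicle (desk (P-1) «+0»).

## References
* [Rogawski1990] J. D. Rogawski, *Automorphic Representations of Unitary Groups in Three Variables*, Ann. of Math. Stud. 123 (1990): §3.6 pp. 28–29 (Cartan subgroups
  and stable conjugacy in `U(3)`), §4.9 Prop. 4.9.1 p. 55 (the transfer at the identity; unipotent orbital integrals).
* [LabesseLanglands1979] J.-P. Labesse, R. P. Langlands, *L-indistinguishability for SL(2)*, Canad. J. Math. 31 (1979): §2 (norm classes `F^×∕N(E^×)`).
-/

noncomputable section

namespace Summit.HodgeConjecture.HodgeConjecture.Cruxes.H413.F0P3cDyRamFourFrameUnipotentLabelDefs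

open MeasureTheory Measure NumberField IsDedekindDomain Topology Filter
open Literature.NumberTheory.Automorphic Literature.NumberTheory.Automorphic.UnitaryGroup Literature.NumberTheory.Automorphic.IntegralReduction
open Literature.NumberTheory.Rogawski1990 Literature.NumberTheory.GaloisRepresentations
open Literature.NumberTheory.Automorphic.HermitianLattice Literature.NumberTheory.Automorphic.UnitaryThreeFourFrame
open Summit.HodgeConjecture.HodgeConjecture.Cruxes.H413.F0P3cDyRamFourFramePieces
open scoped Matrix MatrixGroups Classical ValuativeRel WithZero

/-- **`NormClassPlus σ ϖ d X`** — the non-zero values of the `Φ₃`-pairing `y ↦ ⟨y, X·y⟩` (over ALL `y ∈ K³`) meet the norm class of the reference class-`+` nilpotent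
★ `xPlus σ ϖ d`: `∃ y y' z, ⟨y, Xy⟩ ≠ 0 ∧ ⟨y, Xy⟩ = ⟨y', X₊·y'⟩ · (z·σz)`.  A `U(Φ₃)(K)`-conjugation invariant of `X` (class function); for transvections it is the norm
class `a∕c ∈ N(E^×)` of the skew coefficient.  A definition; nothing asserted. -/
def NormClassPlus {K : Type*} [Field K] (σ : K →+* K) (ϖ : K) (d : ℕ) (X : Matrix (Fin 3) (Fin 3) K) : Prop :=
  ∃ y y' : Fin 3 → K, ∃ z : K,
    UnitaryLatticeTree.pairing σ ((StdForm.antidiagonal 3).over K) y (X.mulVec y) ≠ 0 ∧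
    UnitaryLatticeTree.pairing σ ((StdForm.antidiagonal 3).over K) y (X.mulVec y) =
      UnitaryLatticeTree.pairing σ ((StdForm.antidiagonal 3).over K) y' ((xPlus σ ϖ d).mulVec y') * (z * σ z)

/-- **`unipotentLabel L w hw ϖ c : Fin 4`** — THE EXPLICIT LABEL of a conjugacy class `c` of `G_v = U(Φ₃)(L⁺_v)` by the columns of ★ `gselStar = (1_K, f_{T+}, f_{T−}, f_reg)`:
with `X := wMatrix (Quotient.out c) − 1` (read at the `σ`-stable place `w` through ★ `localNonsplitEquiv`), `0` if `X = 0`; `1` if `X ≠ 0 ∧ X·X = 0 ∧ NormClassPlus`;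
`2` if `X ≠ 0 ∧ X·X = 0 ∧ ¬NormClassPlus`; `3` if `X·X ≠ 0`.  Representative-free on the nose for labels `0` and `3` (`X = 0`, `X² = 0` are conjugation-invariant) and
for `1`∕`2` by the invariance of `NormClassPlus`.  The restriction to a unipotent `S` is the labelling `e : ↥S → Fin 4` the U4 assembly feeds to ★ `RankTableWild
gselStar`.  A definition; nothing asserted (injectivity on unipotent classes = `stub_U4_label_injOn`). -/
def unipotentLabel (L : Type) [Field L] [NumberField L] [IsCMField L] {v : HeightOneSpectrum (𝓞 ↥(maximalRealSubfield L))}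
    (w : UnitaryGroup.PlacesOver L v) (hw : IsCMField.complexConj L • w.1 = w.1) (ϖ : w.1.adicCompletion L)
    (c : ConjClasses ((UnitaryGroup.cmDatum L 3 (Matrix.of fun i j : Fin 3 => if i.val + j.val + 1 = 3 then (1 : L) else 0)).Local v)) : Fin 4 :=
  if wMatrix L w hw (Quotient.out c) - 1 = 0 then 0
  else if (wMatrix L w hw (Quotient.out c) - 1) * (wMatrix L w hw (Quotient.out c) - 1) = 0 then
    (if NormClassPlus (galAdicCompletionMap (L := L) (IsCMField.complexConj L) hw) ϖ (dOfPlace L v w) (wMatrix L w hw (Quotient.out c) - 1) then 1 else 2)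
  else 3

end Summit.HodgeConjecture.HodgeConjecture.Cruxes.H413.F0P3cDyRamFourFrameUnipotentLabelDefs

end
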